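import Summits.BirchSwinnertonDyer.Rank1Residual.JET.E0ReceptacleOfEmbedding
import Summits.BirchSwinnertonDyer.Rank1Residual.JET.ZhangKolyvaginPrimeGross
import Literature.NumberTheory.EllipticCurves.HeegnerPointsIdentityComponent
import Literature.NumberTheory.EllipticCurves.NonEisensteinPrimeOfSurjective
import Literature.NumberTheory.EllipticCurves.AnomalousOfRationalTorsionProofs
import Literature.NumberTheory.EllipticCurves.MazurTorsionOrderValuationProofs
import Summits.BirchSwinnertonDyer.BirchSwinnertonDyer.Theorems.Rank1ResidualJetCarrierMultEndForm
import HarnessLib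

/-!
# T1 JET (cell `bsd-jet`), road K: the END FORMs' receptacle binder `hGZ` BY NAME — from the
# Literature fact `Gross1991_heegnerPoint_sub_ratTorsion_mem_E0` (Gross 1991 §6 / [GZ86, III (3.1)])
# and the transport `E₀(K[m])_w → E0Receptacle (W⁄K) v` along an embedding `K[m] → K̄_v`

HONEST FRAMING (programme file §HONESTY, verbatim): «no tranche here proves BSD; ARM L moves the
LITERAL column of an r ≤ 1 census into the kernel-proved-modulo-named-print column.» THEOREMS ONLY
(seat `bsd-jet-ty` g8); 0 classes move by design; nothing here is a new fact, nothing is asserted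
about BSD. WHAT THIS IS. The road-K END FORMs (`jetchevDivisibilityCarrier{Ne,Mult,Add}_of_localFacts`,
seat `bsd-jet-pv-2`) carry a CLOSED cite-only binder `hGZ` — "the Heegner points `γ y_m`, `γ y_{m/ℓ}`
land, after an integer multiple `n'` prime to `p`, in the receptacle `E⁰(K̄_v)` at every bad place `v`
of `E/K`" — which the cell's reader (D-AUDIT-JET-read-1, ADDENDUM-8 §B(e), ANNEX-5 §2) classed
SATISFIABILITY-UNVERIFIED and asked to be replaced BY NAME by the Literature fact
`Gross1991_heegnerPoint_sub_ratTorsion_mem_E0` (Gross 1991, §6, proof of Prop. 6.2 (1), p. 245, from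
Gross–Zagier 1986, III (3.1): at a place `w ∣ N` of `K_n` the point `y_n` lies in `E⁰` up to rational
torsion) plus a transport lemma. THIS FILE is that replacement, in the reader's GUARDED shape
(`HGZKolyvagin`: square-free `m` with Zhang–Kolyvagin prime factors — the printed scope, Gross 1991
§3 (3.1)) and under the END FORMs' frame hypotheses (`E` without CM, `K` imaginary quadratic with
`d_K ≠ −3, −4` and the Heegner hypothesis, `p` odd with `ρ̄_{E,p}` onto), with the witness
`n' := #E(ℚ)_tors` (prime to `p` because `ρ̄_{E,p}` is irreducible, tree
`not_hasIrreducibleModPGaloisRep_of_dvd_torsionOrder`):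
* `pointsMap_map_mem_E0Receptacle_of_forall_place` — the transport: for `W/ℚ` integral, a place `v`
  of `K` with `(W⁄K) ⊗ K_v` minimal and `N ∈ v`, a number field `L` with a `ℚ`-embedding
  `f : L → K̄`, and `P ∈ E(L)` with nonsingular reduction on `W` at EVERY place `w ∣ N` of `L`:
  the image of `P` in `E(K̄_v)` (along `K̄ → K̄_v`) lies in `E0Receptacle (W⁄K) v` — by the place
  `w` of `L` cut out by `L → K̄_v` (`exists_heightOneSpectrum_isEquiv_comap`, it divides `v`, so
  `w ∣ N`) and the dictionary `mem_E0Receptacle_some_iff_hasNonsingularReduction_placeIntModel`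
  (Silverman VII.1.3 (b): two minimal equations differ by an integral unimodular change of
  coordinates, which preserves `E₀`);
* `conductorNorm_mem_and_isMinimal_of_not_hasGoodReductionAt` — at a bad place `v` of `E/K`:
  `N ∈ v` (the prime `q` under `v` is bad for `E/ℚ`, Silverman VII.5.1 (a) via the tree's
  `hasGoodReductionAt_baseChange_of_hasGoodReductionAt_rat`, so `q ∣ N`) and `(W⁄K) ⊗ K_v` is a
  minimal equation (`q` splits in `K` by the Heegner hypothesis, `e = f = 1`, tree
  `carrierRowData_of_split`);
* `hGZ_of_Gross1991` — the END: the guarded `hGZ` with `n' = #E(ℚ)_tors`, both clauses (level `m`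
  with datum `dm`, and level `m/ℓ` with datum `dm'` read in `K[m]`), from the fact at the
  Gross–Kolyvagin conductors `m`, `m/ℓ` (Zhang–Kolyvagin ⇒ Gross–Kolyvagin at odd `p` under `ρ̄`
  onto, sibling `ZhangGross.forall_isKolyvaginPrime_of_zhang`) and `#E(ℚ)_tors • t = O`.
The hypothesis `γ ∈ 𝒢_m` of the binder is not used (any `ℚ`-automorphism of `K[m]` composed with
the datum's embedding is again a `ℚ`-embedding `K[m] → K̄`).

References: [cite: GrossLMS1991, §6, proof of Prop. 6.2 (1), p. 245; §1 p. 235; §3 (3.1)–(3.3) p. 239]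
[cite: GrossZagier1986Heegner, III (3.1) Proposition, p. 256] [cite: SilvermanAEC2009, VII.1 Prop. 1.3 (b),
VII.2 Prop. 2.1, VII.5 Prop. 5.1 (a)] [cite: CasselsFrohlichANT1967, Ch. II §10, Ch. VII Prop. 1.2 (ii)].

presearch (D-0021): `lean search 'hGZ_of|HGZKolyvagin|mem_E0Receptacle_of'` → the tree has only the
Kodaira–Néron-CLASS supply `X11b.hGZ_of_kodairaNeron` (sub-class (KN): `c_v = 1` at all bad `v`), not
the by-name supply from [GZ86, III (3.1)]; corpus `lit search --hybrid "Heegner point identity component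
bad reduction Gross Zagier III 3.1"` → GrossLMS1991 p. 245, GrossZagier1986 p. 256 (the cited lines).
-/

set_option autoImplicit false

noncomputable section

open scoped Classical Pointwise NNReal

open WeierstrassCurve IsDedekindDomain NumberField Field Literature.NumberTheory.EllipticCurves
  Literature.NumberTheory.EllipticCurves.ModularForms
  Literature.NumberTheory.GaloisRepresentations
  Summit.BirchSwinnertonDyer.Rank1Residual.X11b Literature.NumberTheory.Automorphic

namespace Summit.BirchSwinnertonDyer.Rank1Residual.JET

/-! ## The transport `E₀(L)_w (all w ∣ N) → E0Receptacle (W⁄K) v` -/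

/-- **Transport of `E⁰` along an embedding.** For `W/ℚ` with integer coefficients, a finite place
`v` of the number field `K` at which `(W⁄K) ⊗ K_v` is a minimal equation and with `N ∈ v`, a number
field `L` with a `ℚ`-embedding `f : L → K̄`, and a point `P ∈ E(L)` with nonsingular reduction on
`W` at every place `w` of `L` containing `N`: the image of `P` in `E(K̄_v)` lies in the receptacle
`E⁰(K̄_v)` of `(W⁄K, v)`. (The place `w` of `L` under `L → K̄ → K̄_v` divides `v ∋ N`; on minimal
equations `E₀` is read through Silverman VII.1.3 (b). `[DecidableEq L]` is the instance of the group
law on `E(L)` carried by `Affine.Point.map`, arbitrary so that the lemma applies to `L = K[m] ⊂ ℂ`.)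
[cite: SilvermanAEC2009, VII.1 Prop. 1.3 (b), VII.2 Prop. 2.1] [cite: CasselsFrohlichANT1967, Ch. II §10] -/
theorem pointsMap_map_mem_E0Receptacle_of_forall_place (W : WeierstrassCurve ℚ) [W.IsIntegral ℤ]
    [W.IsElliptic] {K : Type} [Field K] [NumberField K] (v : HeightOneSpectrum (𝓞 K))
    (hmin : ((W.baseChange K).baseChange (v.adicCompletion K)).IsMinimal (v.adicCompletionIntegers K))
    {N : ℕ} (hNv : ((N : ℕ) : 𝓞 K) ∈ v.asIdeal) {L : Type} [Field L] [NumberField L]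
    [DecidableEq L] (f : L →ₐ[ℚ] AlgebraicClosure K) (P : (W.baseChange L).toAffine.Point)
    (hP : ∀ w : HeightOneSpectrum (𝓞 L), ((N : ℕ) : 𝓞 L) ∈ w.asIdeal →
      (placeIntModel W L w).HasNonsingularReduction (K := L) P) :
    pointsMap (W.baseChange K) (v.adicCompletion K) (Affine.Point.map (W' := W) f P) ∈
      E0Receptacle (W.baseChange K) v := by
  obtain ⟨w₀, hw₀⟩ := v.exists_spectralValuation
  -- the embedding `L → K̄ → K̄_v` and the place `w` of `L` it cuts out
  set f' : L →ₐ[ℚ] AlgebraicClosure (v.adicCompletion K) :=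
    ((closureEmb (K := K) (v.adicCompletion K)).restrictScalars ℚ).comp f with hf'
  obtain ⟨w, hwe, hwN⟩ :=
    Literature.NumberTheory.EllipticCurves.exists_heightOneSpectrum_isEquiv_comap hw₀
      (f' : L →+* AlgebraicClosure (v.adicCompletion K))
  rcases P with _ | ⟨x, y, hxy⟩
  · have h0 : pointsMap (W.baseChange K) (v.adicCompletion K)
        (Affine.Point.map (W' := W) f .zero) = 0 := rfl
    rw [h0]
    exact zero_mem _
  · have hxy' : ((W.baseChange K).baseChange (AlgebraicClosure K)).toAffine.Nonsingular (f x) (f y) :=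
      (Affine.baseChange_nonsingular W f.injective x y).mpr hxy
    have h' : ((W.baseChange K).baseChange (AlgebraicClosure (v.adicCompletion K))).toAffine.Nonsingular
        ((f' : L →+* AlgebraicClosure (v.adicCompletion K)) x)
        ((f' : L →+* AlgebraicClosure (v.adicCompletion K)) y) :=
      (Affine.baseChange_nonsingular W f'.injective x y).mpr hxy
    have hQ : pointsMap (W.baseChange K) (v.adicCompletion K)
        (Affine.Point.map (W' := W) f (.some x y hxy)) = .some _ _ h' := by
      rw [Affine.Point.map_some]
      change Affine.Point.map (W' := W.baseChange K) (closureEmb (K := K) (v.adicCompletion K))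
        (.some (f x) (f y) hxy') = _
      rw [Affine.Point.map_some]
      rfl
    exact (mem_E0Receptacle_some_iff_hasNonsingularReduction_placeIntModel W v hw₀ hmin
      (f' : L →+* AlgebraicClosure (v.adicCompletion K)) hwe hxy h' hQ).mpr (hP w (hwN N hNv))

/-! ## Bad places of `E/K` under the Heegner hypothesis -/

/-- **At a bad place `v` of `E/K`: `N ∈ v` and `W ⊗ K_v` is minimal.** For `W/ℚ` a global minimal
model of conductor `N`, `K` imaginary quadratic satisfying the Heegner hypothesis for `N`, and `v` a
finite place of `K` at which `E/K` does not have good reduction: the prime `q` under `v` is bad for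
`E/ℚ` (good reduction ascends, Silverman VII.5.1 (a)), so `q ∣ N ∈ v`; and `q` splits in `K`
(Heegner hypothesis), so `K_v = ℚ_q` (`e = f = 1`) and the minimal `W ⊗ ℚ_q` stays minimal over
`𝓞_v`. [cite: SilvermanAEC2009, VII.5 Prop. 5.1 (a), VII.1 Prop. 1.3 (b)]
[cite: CasselsFrohlichANT1967, Ch. II §10, Ch. VII Prop. 1.2 (ii)] [cite: GrossLMS1991, §1 (Heegner hypothesis)] -/
theorem conductorNorm_mem_and_isMinimal_of_not_hasGoodReductionAt (W : WeierstrassCurve ℚ)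
    [W.IsElliptic] [W.IsGloballyMinimal] {K : Type} [Field K] [NumberField K]
    (hK : IsImaginaryQuadratic K) (hH : SatisfiesHeegnerHypothesis (W.conductorNorm ℤ) K)
    {v : HeightOneSpectrum (𝓞 K)} (hv : ¬ (W.baseChange K).HasGoodReductionAt v) :
    ((W.conductorNorm ℤ : ℕ) : 𝓞 K) ∈ v.asIdeal ∧
      ((W.baseChange K).baseChange (v.adicCompletion K)).IsMinimal (v.adicCompletionIntegers K) := by
  -- the rational prime `q` under `v`: bad for `E/ℚ`, so `q ∣ N`
  set vq : HeightOneSpectrum (𝓞 ℚ) := v.under (𝓞 ℚ) with hvq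
  set q : ℕ := (Rat.HeightOneSpectrum.primesEquiv vq : ℕ) with hqdef
  have hq : q.Prime := (Rat.HeightOneSpectrum.primesEquiv vq).2
  haveI : Fact q.Prime := ⟨hq⟩
  haveI : v.asIdeal.LiesOver vq.asIdeal := ⟨rfl⟩
  have hqN : q ∣ W.conductorNorm ℤ := (W.dvd_conductorNorm_iff vq).mpr fun h ↦
    hv (hasGoodReductionAt_baseChange_of_hasGoodReductionAt_rat W vq v h)
  have hqvq : ((q : ℕ) : 𝓞 ℚ) ∈ vq.asIdeal :=
    (natCast_mem_asIdeal_iff_eq_primesEquiv_symm vq hq).mpr (Equiv.symm_apply_apply _ _).symm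
  have hqv : ((q : ℕ) : 𝓞 K) ∈ v.asIdeal := by
    have h := Ideal.mem_comap.mp hqvq
    rwa [map_natCast] at h
  have hNv : ((W.conductorNorm ℤ : ℕ) : 𝓞 K) ∈ v.asIdeal := by
    obtain ⟨c, hc⟩ := hqN
    rw [hc, Nat.cast_mul]
    exact v.asIdeal.mul_mem_right _ hqv
  refine ⟨hNv, ?_⟩
  -- `Gal(K/ℚ) = {1, τ}`
  haveI : Algebra.IsQuadraticExtension ℚ K := ⟨hK.1⟩
  have hcard : Nat.card (K ≃ₐ[ℚ] K) = 2 := by rw [IsGalois.card_aut_eq_finrank, hK.1]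
  obtain ⟨τ, hτ, huniq⟩ := (Nat.card_eq_two_iff' (1 : K ≃ₐ[ℚ] K)).mp hcard
  have hτ2 : τ * τ = 1 := by
    rw [mul_eq_one_iff_eq_inv]
    exact (huniq τ⁻¹ (inv_ne_one.mpr hτ)).symm
  -- a place `v₀ ∣ q` with `τ • v₀ ≠ v₀`; `v` is `v₀` or `τ • v₀`
  obtain ⟨v₀, hv₀, -, hqv₀⟩ := exists_split_place_of_dvd K hK τ hτ hH q hqN
  obtain ⟨σ, hσ⟩ := HeightOneSpectrum.exists_algEquiv_smul_eq (F := ℚ) (w := v₀) (w' := v)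
    (LocalField.heightOneSpectrum_rat_eq_of_natCast_mem q _ _
      (LocalField.natCast_mem_under q v₀ hqv₀) (LocalField.natCast_mem_under q v hqv))
  have hτv : τ • v ≠ v := by
    by_cases hσ1 : σ = 1
    · subst hσ1
      rw [one_smul] at hσ
      subst hσ
      exact hv₀
    · have hστ : σ = τ := huniq σ hσ1
      subst hστ
      subst hσ
      rw [smul_smul, hτ2, one_smul]
      exact fun h ↦ hv₀ h.symm
  obtain ⟨hmin, -, -, -, -⟩ := carrierRowData_of_split W K q hK τ v hτv hqv
  exact hmin

/-! ## The END: `hGZ` by name -/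

/-- **The END FORMs' receptacle binder `hGZ`, BY NAME, from Gross 1991 §6 / [GZ86, III (3.1)]** (the
reader's guarded shape `HGZKolyvagin`, witness `n' = #E(ℚ)_tors`). For `W/ℚ` a global minimal model
without CM, of conductor `N`, `K` imaginary quadratic with `d_K ≠ −3, −4` in which every prime
dividing `N` splits, `p` an odd prime with `ρ̄_{E,p} : Gal(ℚ̄/ℚ) → GL₂(𝔽_p)` onto, a modular
parametrisation `Dt` of level `N`, `β`, `ι : K → ℂ`: GRANTED the fact
`Gross1991_heegnerPoint_sub_ratTorsion_mem_E0`, `n' := #E(ℚ)_tors` is prime to `p`, and for every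
square-free `m` all of whose prime factors are (Zhang–)Kolyvagin primes for `p`, every
Kolyvagin–Heegner datum `dm` of level `m`, every `γ ∈ Aut(K[m])` and every finite place `v` of `K` of
bad reduction for `E/K`: `n' • (γ y_m)_v ∈ E⁰(K̄_v)` and, for every prime `ℓ ∣ m` and datum `dm'` of
level `m/ℓ` read in `K[m] ⊇ K[m/ℓ]`, `n' • (γ y_{m/ℓ})_v ∈ E⁰(K̄_v)` — Gross, p. 245: "for any place
`w` dividing `v` in `K_n` … `y_n` is, up to translation by rational torsion on `E`, in `E⁰`".
[cite: GrossLMS1991, §6, proof of Prop. 6.2 (1), p. 245; §3 (3.1)–(3.3) p. 239]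
[cite: GrossZagier1986Heegner, III (3.1) Proposition, p. 256]
[cite: SilvermanAEC2009, VII.1 Prop. 1.3 (b), VII.2 Prop. 2.1, VII.5 Prop. 5.1 (a)] -/
theorem hGZ_of_Gross1991 (hF1 : Gross1991_heegnerPoint_sub_ratTorsion_mem_E0)
    (W : WeierstrassCurve ℚ) [W.IsElliptic] [W.IsGloballyMinimal] [NeZero (W.conductorNorm ℤ)]
    (hcm : ¬ W.HasCM) (K : Type) [Field K] [NumberField K] (hK : IsImaginaryQuadratic K)
    (hD3 : NumberField.discr K ≠ -3) (hD4 : NumberField.discr K ≠ -4)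
    (hH : SatisfiesHeegnerHypothesis (W.conductorNorm ℤ) K) (p : ℕ) [Fact p.Prime] (hp2 : p ≠ 2)
    (hsurj : W.HasSurjectiveModNGaloisRep p)
    (Dt : ModularParametrizationData W (W.conductorNorm ℤ)) (β : ℤ) (ι : K →+* ℂ)
    [∀ j : ℕ, NumberField (ringClassField K ι j)] :
    ∃ n' : ℤ, IsCoprime (p : ℤ) n' ∧ ∀ (m : ℕ), Squarefree m →
      (∀ q ∈ m.primeFactors, Zhang2014.IsKolyvaginPrime (W.conductorNorm ℤ) W K p q) →
      ∀ (dm : KolyvaginHeegnerData Dt β ι m)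
        (γ : ringClassField K ι m ≃ₐ[ℚ] ringClassField K ι m), γ ∈ ringClassGal ι m →
        ∀ v : HeightOneSpectrum (𝓞 K), ¬ (W.baseChange K).HasGoodReductionAt v →
          n' • pointsMap (W.baseChange K) (v.adicCompletion K)
              (dm.toGeomPoints (pointGalHom W (ringClassField K ι m) γ dm.y)) ∈
            E0Receptacle (W.baseChange K) v ∧
          ∀ (ℓ : ℕ), ℓ ∈ m.primeFactors → ∀ (dm' : KolyvaginHeegnerData Dt β ι (m / ℓ))
            (hle : ringClassField K ι (m / ℓ) ≤ ringClassField K ι m),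
            n' • pointsMap (W.baseChange K) (v.adicCompletion K)
                (dm.toGeomPoints (pointGalHom W (ringClassField K ι m) γ
                  (WeierstrassCurve.Affine.Point.map (W' := W)
                    ((RingClassField.inclusion ι hle).restrictScalars ℚ) dm'.y))) ∈
              E0Receptacle (W.baseChange K) v := by
  have hp : p.Prime := Fact.out
  haveI : NeZero (p : ℚ) := ⟨Nat.cast_ne_zero.mpr hp.ne_zero⟩
  refine ⟨(W.torsionOrder : ℤ), ?_, ?_⟩
  · -- `p ∤ #E(ℚ)_tors`: a rational point of order `p` contradicts `ρ̄_{E,p}` irreducible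
    exact Nat.isCoprime_iff_coprime.mpr ((Nat.Prime.coprime_iff_not_dvd hp).mpr fun h ↦
      not_hasIrreducibleModPGaloisRep_of_dvd_torsionOrder W p h
        (hasIrreducibleModPGaloisRep_of_hasSurjectiveModNGaloisRep W p hsurj))
  have htors : ∀ t : W.toAffine.Point, IsOfFinAddOrder t → W.torsionOrder • t = 0 := fun t ht ↦
    addOrderOf_dvd_iff_nsmul_eq_zero.mp (addOrderOf_dvd_torsionOrder W ht)
  intro m hm hKolZ dm γ _ v hv
  have hKol : ∀ ℓ ∈ m.primeFactors, IsKolyvaginPrime (W.conductorNorm ℤ) W K p ℓ :=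
    ZhangGross.forall_isKolyvaginPrime_of_zhang W K hK hp2 hsurj hKolZ
  obtain ⟨hNv, hmin⟩ := conductorNorm_mem_and_isMinimal_of_not_hasGoodReductionAt W hK hH hv
  refine ⟨?_, fun ℓ hℓ dm' hle ↦ ?_⟩
  · -- level `m`, datum `dm`
    have hE0 : ∀ w : HeightOneSpectrum (𝓞 (ringClassField K ι m)),
        ((W.conductorNorm ℤ : ℕ) : 𝓞 (ringClassField K ι m)) ∈ w.asIdeal →
        (placeIntModel W (ringClassField K ι m) w).HasNonsingularReduction (K := ringClassField K ι m)
          (W.torsionOrder • dm.y) := fun w hw ↦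
      hF1.nsmul_of_forall_torsion hcm hK ⟨hD3, hD4⟩ hH hp hp2 hsurj hm hKol dm htors w hw
    rw [← map_zsmul (pointsMap (W.baseChange K) (v.adicCompletion K)), ← map_zsmul dm.toGeomPoints,
      ← map_zsmul (pointGalHom W (ringClassField K ι m) γ), natCast_zsmul, pointGalHom_apply]
    change pointsMap (W.baseChange K) (v.adicCompletion K)
      (Affine.Point.map (W' := W) dm.emb.toRatAlgHom
        (Affine.Point.map (W' := W) (γ : ringClassField K ι m →ₐ[ℚ] ringClassField K ι m)
          (W.torsionOrder • dm.y))) ∈ _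
    rw [Affine.Point.map_map]
    exact pointsMap_map_mem_E0Receptacle_of_forall_place W v hmin hNv _ _ hE0
  · -- level `m / ℓ`, datum `dm'` read in `K[m]`
    have hmℓ : m / ℓ ∣ m := Nat.div_dvd_of_dvd (Nat.dvd_of_mem_primeFactors hℓ)
    have hE0 : ∀ w : HeightOneSpectrum (𝓞 (ringClassField K ι (m / ℓ))),
        ((W.conductorNorm ℤ : ℕ) : 𝓞 (ringClassField K ι (m / ℓ))) ∈ w.asIdeal →
        (placeIntModel W (ringClassField K ι (m / ℓ)) w).HasNonsingularReduction
          (K := ringClassField K ι (m / ℓ)) (W.torsionOrder • dm'.y) := fun w hw ↦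
      hF1.nsmul_of_forall_torsion hcm hK ⟨hD3, hD4⟩ hH hp hp2 hsurj (hm.squarefree_of_dvd hmℓ)
        (fun q hq ↦ hKol q (Nat.primeFactors_mono hmℓ hm.ne_zero hq)) dm' htors w hw
    rw [← map_zsmul (pointsMap (W.baseChange K) (v.adicCompletion K)), ← map_zsmul dm.toGeomPoints,
      ← map_zsmul (pointGalHom W (ringClassField K ι m) γ),
      ← map_zsmul (Affine.Point.map (W' := W) ((RingClassField.inclusion ι hle).restrictScalars ℚ)),
      natCast_zsmul, pointGalHom_apply]
    change pointsMap (W.baseChange K) (v.adicCompletion K)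
      (Affine.Point.map (W' := W) dm.emb.toRatAlgHom
        (Affine.Point.map (W' := W) (γ : ringClassField K ι m →ₐ[ℚ] ringClassField K ι m)
          (Affine.Point.map (W' := W) ((RingClassField.inclusion ι hle).restrictScalars ℚ)
            (W.torsionOrder • dm'.y)))) ∈ _
    rw [Affine.Point.map_map, Affine.Point.map_map]
    exact pointsMap_map_mem_E0Receptacle_of_forall_place W v hmin hNv _ _ hE0

end Summit.BirchSwinnertonDyer.Rank1Residual.JET

end
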